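import Summits.QuantumFields.YangMills.Theorems.BalabanUVNodesN16OfEdgesAllTorusAtRecord13CoPH

/-!
# Route «BalabanUVNodes», crux K3⁸ `SpineGivenEndpointR13SepCoPHV` (stmt-QuantumFields-27366), node N16 = NE3 — THE TOP KNIT, PART (A): NODE N16 AT THE READING OF
# RECORD FROM ITS OWN CHAIN-ENTRY OBJECT «(T4ᵀ_print)_β WITH ONE `(c₁′, B, B_h)` FOR ALL DEPTHS» (`hE`, θ-free, model-free, at `M_N(ℂ)`) AND NODE N07's LINEAR LEAF,
# LETTERS CHOSEN — dag-n16-c's PRINT β-slot `PrintSlotHolder`, THE END's β-uniform proviso `InEndRegimeH`, `N16HolderAt`, and module 37ᴴ's reading-level faces with `h5 ↦ hE`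

Cell `pub-ymgap`, seat `pub-ymgap-dag-n16-e` (R134 acceleration seat (a), strategy s2 = BY-NAME KNIT at the record; HUMAN RULING D-0062; chair R424 venue), generation 24,
module 57 (THEOREMS ONLY, 0 `def`, 0 `sorry`, standard axioms; Theses-free, importable).  `--kind proof --supports stmt-QuantumFields-27366 --as helper` (count-neutral;
proves NO registered stub).  `bears_on: R4∕N16 · edges N05 → N16, N07 → N16 · out-edge N16 → N21 · composite N27`.
WHY (HOME `HANDOFF.md` §g23 «THE TOP KNIT»; `LOCATED-N16-N05-RECORD-CURRENCY.md`).  Every N16 producer feeding K3⁸'s N16 rows bottoms out at ONE per-family hypothesis `h5` in the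
ℤᵈ currency (node N05's `Thm4Body` ∕ `Prop3Body` on the PINNED ALL-TORUS members of `zdGF3 (M_N ℂ) F.L β len`; module 37ᴴ :110–111), while node N05's witness of record is the
κ-PERIODIC Σ-object over `zdGF3HP₂Per` (p681888); generation 23 typed that seam down to N16's CHAIN-ENTRY HYPOTHESIS (p683332): ONE `(c₁′, B, B_h)` with, for EVERY depth `k ≥ 1`,
[Balaban1985RegularSpaces] Theorem 4 in the all-torus geometry at the period `Nper·F.Lᵏ`, conclusion in print's letters at Hölder exponent `β` — the (T4ᵀ_print)_β hypothesis of
dag-n16-c's `n16_holder_of_thm4TorusAt_print`.  THIS MODULE keys N16's record-side knit on that entry object ITSELF (`hE`, θ-free at `M_N(ℂ)`, `Reg := ⊤` — `Thm4TorusAt` is antitone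
in `Reg`, §0), served by BOTH roads (κ-periodic: p683332 at the matrix-valued Stage-3 dictionary of the family, module 58; ℤᵈ: `h5` through n16-c F47 + `thm4TorusAt_print_of_zd`).
Per family: `hE F` + node N07's linear leaf `h7 F` + `g F > 0` ⟹ letters `ℓ` (identities, dag-n21-d's numerals) with THE END's β-uniform proviso `InEndRegimeH` AND dag-n16-c's
PRINT β-slot `PrintSlotHolder · β` at RR-1's object (window recipe of modules 13∕17∕27∕(F2) with `(B, B_h)` abstract), hence `N16HolderAt · β` by the ONE-APPLICATION CLOSER
`n16HolderAt_of_inEndRegimeH_printSlotHolder` (`β ≤ 1`), hence module 37ᴴ's reading-level faces with `h5 ↦ hE` — no letter line left to the composer; `Rg`, `w1`, `ne2`, `ne1` free.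

WHAT IS PROVED ([folklore] bookkeeping BY NAME + real arithmetic on letters; no estimate).  §0 `thm4TorusAt_of_reg_true` · §1 `exists_window_letters_entry` (module 27 §1, `(B, B_h)`
abstract) · §2 ★ `printSlotHolder_ofRecord_of_entry_window_lines` ∕ `…_linear` · §3 ★★ `exists_letters_inEndRegimeH_printSlotHolder_of_entry` · `exists_letters_n16HolderAt_of_entry` ·
§4 ★★★ `h5 ↦ hE` twins of module 37ᴴ §2 ∕ §1: `exists_letters_s_N16Holder_readingOfRecord₁₃CoPHOn_of_entry` · `…₁₃CoPH_of_entry` (`β ≤ 1`) · `exists_letters_s_N16_readingOfRecord₁₃CoPHOn_of_entry` ·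
`…₁₃CoPH_of_entry` (β = 1).

HONEST FRAMING.  Bookkeeping BY NAME (a `choose` over displayed letter lines; the closer packages `n16_holder_of_thm4TorusAt_print`, THE END's road, ALREADY LANDED); no estimate
of Bałaban's is proved here.  `hE` ([Balaban1985RegularSpaces] Thm 4 p. 88 with Prop. 3's letters (1.36)–(1.39), Hölder member at exponent `β` AS PRINTED, «β ≦ β₀ < 1» p. 82, all-torus
geometry, every depth, ONE threshold) and `h7` (node N07's [Balaban1985Variational] Thm 1 (8)+(10) TYPE, linear letters) are DISPLAYED HYPOTHESES asserted for no family; `hE` is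
inhabited by node N05's Σ-object GIVEN node N06's per-period binders (N06 content, not discharged) or by the ℤᵈ `h5` GIVEN [4]'s letters at unbounded domains; `w1` ∕ `ne2` ∕ `ne1` are
residual DATA; no admissible Stage-13 tuple is claimed to exist (K0 OPEN); no stub of K3⁸ v7 closed or claimed; **N16 ∕ N05 ∕ N06 ∕ N07 ∕ N27 NOT discharged**; counts UNMOVED
(typed 28∕28 · discharged 7∕27 · A 7∕28 — the chair's line is the only count).  One finite four-torus at fixed `ε`, Bałaban AS PRINTED — NOT ℝ⁴, NOT infinite volume, NOT OS, NOT
a mass gap; the Yang–Mills mass gap (Clay) is NOT proved by any of this — R4 closes the conditional finite-𝕋⁴ rung `BalabanLadder.UV` only.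
References: [Balaban1985RegularSpaces] T. Bałaban, CMP **99** (1985) 75–102, Thm 4 p. 88, Prop. 3 p. 87; [Balaban1985Variational] T. Bałaban, CMP **102** (1985) 277–309, Thm 1 p. 279.
-/

set_option autoImplicit false

open scoped BigOperators Matrix Matrix.Norms.L2Operator
open NormedSpace

namespace Summit.QuantumFields.YangMills.BalabanUVNodes.N16OfEntryAtRecord13CoPH

open Literature.MathematicalPhysics.QuantumFieldTheory.Balaban1983to89
open Literature.MathematicalPhysics.QuantumFieldTheory.Balaban1983to89.T4Continuum (T4Family ULoop)
open B7Prop1Explicit B7Prop2Explicit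
open T4AveragingDeficitWall (Ad)
open B7Eq92Concrete (mgauge)
open B8Ineq132 (covDerivFwd)
open B8Eq184Proof (cfgExp)
open B8Eq119TwistedAxial (Restr129)
open B8Eq133Hypotheses (Reg335Zd)
open B8Eq138LandauZd (covLap IsLandau138)
open B8Thm4TorusAt (torusLam Thm4TorusAt)
open Node00 (Stage13HParams NE3Objects₁₁ NE3Letters₁₁ NE2Objects₁₁ ne3ConstLayerOfRecord₁₁ ne3NperOfRecord₁₁ ne3DomOfRecord₁₁ one_le_ne3NperOfRecord₁₁ MatA)
open Node00.W1 (ReadingData)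
open Summit.QuantumFields.BalabanUV.T4Continuum
open BlockAverageCurrent (curConst curConst_nonneg)
open NE3RightInverseSupLetters (frameC)
open NE3.LeafIndexSockets (LeafH3sup)
open YMDAG.UVSplit (Datum NE3Carriers NE1pCarriers S_N16 ne3OfRecord₁₁ RRec₁₃CoPH RRec₁₃CoPHOn readingOfRecord₁₃CoPH readingOfRecord₁₃CoPH_ne3)
open Summit.QuantumFields.YangMills.BalabanUVNodes.N16Regime (PrintSlot)
open Summit.QuantumFields.YangMills.BalabanUVNodes.N16HolderDefs (N16HolderAt S_N16Holder)
open Summit.QuantumFields.YangMills.BalabanUVNodes.N16HolderRegime (PrintSlotHolder InEndRegimeH radiusOfRecordH constOfRecordH radiusOfRecordH_pos printSlotHolder_one_iff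
  n16HolderAt_of_inEndRegimeH_printSlotHolder n16At_of_inEndRegimeH_printSlot)
open Summit.QuantumFields.YangMills.BalabanUVNodes.N16HolderSlotWindow (inEndRegimeH_ofRecord_of_window)
open Summit.QuantumFields.YangMills.BalabanUVNodes.N16SlotWindowLinear (slotLetterLines leafLines_of_linear)
open Summit.QuantumFields.YangMills.BalabanUVNodes.N16AtRecord13OfEdges (exists_window_letters_linearLeaf)
open Summit.QuantumFields.YangMills.BalabanUVNodes.N16AtRRec13CoPH (s_N16_rRec₁₃CoPHOn_iff_ofRecord s_N16_rRec₁₃CoPH_iff_of_constLayer)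
open Summit.QuantumFields.YangMills.BalabanUVNodes.N16AtRRec13CoPHLines (s_N16Holder_rRec₁₃CoPHOn_iff_ofRecord s_N16Holder_rRec₁₃CoPH_iff_of_constLayer)

noncomputable section

/-! ## §0 `Thm4TorusAt` is antitone in its regularity predicate: the `Reg := ⊤` statement gives every `Reg` -/

section RegTop

variable {d : ℕ} {𝔸 : Type*} [NormedRing 𝔸] [NormedAlgebra ℂ 𝔸] [CompleteSpace 𝔸]

/-- **`Thm4TorusAt … (fun _ ↦ True) …` implies `Thm4TorusAt … Reg …` for EVERY `Reg`** — «(3.35) of [4]» (`Reg U₀`) is a HYPOTHESIS of the interface. [folklore] -/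
theorem thm4TorusAt_of_reg_true {L k : ℕ} {P : ℤ} {η c₁ : ℝ} {G : Subgroup 𝔸ˣ}
    {Restr : (Site d → Fin d → 𝔸ˣ) → (Site d → 𝔸ˣ) → Prop}
    {Concl : ℝ → ℝ → (Site d → Fin d → 𝔸ˣ) → (Site d → Fin d → 𝔸ˣ) → (Site d → 𝔸ˣ) → Prop}
    (h : Thm4TorusAt L k P η c₁ G (fun _ => True) Restr Concl) (Reg : (Site d → Fin d → 𝔸ˣ) → Prop) :
    Thm4TorusAt L k P η c₁ G Reg Restr Concl :=
  fun _ _ h0 h1 hs U₀ U' hG hG' hP hP' hA _ => h h0 h1 hs U₀ U' hG hG' hP hP' hA trivial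

end RegTop

variable {N : ℕ}

/-! ## §1 The letter witness with `(B, B_h)` abstract (module 27 §1 `exists_window_letters_linearLeaf` re-lettered) -/

/-- **THE LETTERS OF THE N16 LINES EXIST, WITH ROOM FOR N07's LINEAR LEAF — `(B, B_h)` ABSTRACT** (`B > 0`, any `B_h`): an averaging letter `α` under the five displayed bounds and
letters `ℓ` with `ℓ.ε < α`, `ℓ.ε ≤ ε₀`, `C·ℓ.ε ≤ α∕2048`, `ℓ.ε ≤ r = ℓ.Λ₁`, `0 < ℓ.b ≤ ℓ.ε∕2`, `ℓ.C = Cof`, `177·α·(B_h + B) ≤ ℓ.Λ₂'`, `0 < ℓ.Λ₂'` and dag-n21-d's numeral — module 27 §1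
at the [4]-inputs `⟨B∕(5·4·L), 1⟩`, `B_h∕(5·4·L)`. [folklore] -/
theorem exists_window_letters_entry (F : T4Family) {c₁' : ℝ} (hc₁' : 0 < c₁') {B : ℝ} (hB : 0 < B) (Bh g : ℝ) {r : ℝ} (hr : 0 < r) (Cof : ℝ)
    {C ε₀ : ℝ} (hC : 0 ≤ C) (hε₀ : 0 < ε₀) :
    ∃ (α : ℝ) (ℓ : NE3Letters₁₁),
      0 < α ∧ α ≤ c₁' / 177 ∧ α ≤ ℓ.Λ₁ / (1770 * B + 1) ∧ α ≤ c2' 4 F.L / 2 ∧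
      α ≤ 1 / ((23040 * (4 : ℝ) ^ 4 * (frameC 4 F.L + 4) ^ 3 + 12) * (1 + curConst 4 F.L) + 1) ∧ α ≤ 1 / 10 ^ 9 ∧
      ℓ.g = g ∧ 0 < ℓ.ε ∧ ℓ.ε < α ∧ ℓ.ε ≤ ε₀ ∧ C * ℓ.ε ≤ α / 2048 ∧ ℓ.ε ≤ r ∧ ℓ.Λ₁ = r ∧ 0 < ℓ.b ∧ ℓ.b ≤ ℓ.ε / 2 ∧ ℓ.C = Cof ∧
      177 * α * (Bh + B) ≤ ℓ.Λ₂' ∧ 0 < ℓ.Λ₂' ∧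
      512 * (4 + 1) * (4 + 4) * (F.L : ℝ) ^ 2 * ℓ.b ≤ 1 := by
  have hL0 : (0 : ℝ) < F.L := by have := HistoryFlow.two_le_L F; positivity
  have h20 : (0 : ℝ) < 5 * ((4 : ℕ) : ℝ) * F.L := by positivity
  let inp : B8.B9Inputs := ⟨B / (5 * ((4 : ℕ) : ℝ) * F.L), 1, by positivity, one_pos⟩
  have hBi : 5 * ((4 : ℕ) : ℝ) * F.L * inp.B₀ = B := by
    show 5 * ((4 : ℕ) : ℝ) * F.L * (B / (5 * ((4 : ℕ) : ℝ) * F.L)) = B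
    field_simp
  have hBhi : 5 * ((4 : ℕ) : ℝ) * F.L * (Bh / (5 * ((4 : ℕ) : ℝ) * F.L)) = Bh := by field_simp
  obtain ⟨α, ℓ, hα, hα1, hα2, hα3, hα4, hα5, hgℓ, hε0, hε, hεε₀, hCε, hεr, hΛ₁, hb0, hb, hCℓ, hΛ₂', hΛ₂'0, hnum⟩ :=
    exists_window_letters_linearLeaf F hc₁' inp (Bh / (5 * ((4 : ℕ) : ℝ) * F.L)) g hr Cof hC hε₀
  rw [hBi] at hα2
  rw [hBi, hBhi] at hΛ₂'
  exact ⟨α, ℓ, hα, hα1, hα2, hα3, hα4, hα5, hgℓ, hε0, hε, hεε₀, hCε, hεr, hΛ₁, hb0, hb, hCℓ, hΛ₂', hΛ₂'0, hnum⟩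

/-! ## §2 The PRINT β-slot at RR-1's object from the entry object's data, the windowed letters and N07's leaf letters -/

/-- **★ THE WINDOW RECIPE FOR dag-n16-c's PRINT β-SLOT, LINE-EXACT** — `PrintSlotHolder (ne3OfRecord₁₁ F o) β` FROM: Theorem 4's constants `(c₁', B, B_h)` (`0 < B`, `0 < c₁'`,
`16·(B·c₁') ≤ 1`); an averaging letter `α` under four window bounds; bundle letters `o.ε < α`, `0 < o.Λ₁`, `177·α·(B_h+B) ≤ o.Λ₂'`; N07's leaf letters `(b', c')` on the slot's four
displayed lines; (T4ᵀ_print)_β at EVERY depth `k ≥ 1` with `Reg := ⊤` at `(F.L, o.Nper)`; `LeafH3sup 4 F.L o.Nper o.ε b' c' o.dom`.  Localisation letters degenerate (`Mc := 0`,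
`C₃₃₅ := 1`, `𝒬 :≡ ∅`); numeric lines by module 17's `slotLetterLines` (`B₁' := B`); Theorem 4 at `Reg335Zd …` by §0. [cite: Balaban1985RegularSpaces, Thm 4 p.88, (1.36)–(1.39) pp.82–83] [folklore] -/
theorem printSlotHolder_ofRecord_of_entry_window_lines (F : T4Family) (o : NE3Objects₁₁ N) {β : ℝ}
    {c₁' B Bh : ℝ} (hB : 0 < B) (hc₁' : 0 < c₁') (h16 : 16 * (B * c₁') ≤ 1)
    {α : ℝ} (hα : 0 < α) (hα1 : α ≤ c₁' / 177) (hα2 : α ≤ o.Λ₁ / (1770 * B + 1)) (hα3 : α ≤ c2' 4 F.L / 2) (hα5 : α ≤ 1 / 10 ^ 9)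
    (hε : o.ε < α) (hΛ₁ : 0 < o.Λ₁) (hΛ₂' : 177 * α * (Bh + B) ≤ o.Λ₂')
    {b' c' : ℝ} (hb' : 0 ≤ b') (hc' : 0 ≤ c')
    (hRb : 2 ^ 15 * ((4 : ℝ) + 1) ^ 2 * ((4 : ℝ) + 4) ^ 2 * (F.L : ℝ) ^ 2 * b' ≤ 1)
    (hcF : 23040 * (4 : ℝ) ^ 4 * (frameC 4 F.L + 4) ^ 3 * (c' + curConst 4 F.L * b' ^ 2) ≤ 1)
    (hXα : b' + 226 * (8 * ((4 : ℝ) + 1) * ((4 : ℝ) + 4)) ^ 2 * b' ^ 2 < α) (hY : 4 * ((4 : ℝ) - 1) * (c' + curConst 4 F.L * b' ^ 2) < α)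
    (hT : ∀ k, 1 ≤ k → Thm4TorusAt F.L k (((o.Nper * F.L ^ k : ℕ) : ℤ)) (((F.L : ℝ) ^ k)⁻¹) c₁' (unitaryUnits (Matrix (Fin N) (Fin N) ℂ))
      (fun _ => True) (Restr129 F.L k (torusLam k))
      (fun (α₀ α₁ : ℝ) (U₀ U' : Site 4 → Fin 4 → (Matrix (Fin N) (Fin N) ℂ)ˣ) (u : Site 4 → (Matrix (Fin N) (Fin N) ℂ)ˣ) =>
        ∃ A : Site 4 → Fin 4 → Matrix (Fin N) (Fin N) ℂ,
          (∀ x μ, IsSelfAdjoint (A x μ)) ∧ (∀ (x : Site 4) (κ μ : Fin 4), A (x + (((o.Nper * F.L ^ k : ℕ) : ℤ)) • e κ) μ = A x μ) ∧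
          mgauge U₀ u (cfgExp (((F.L : ℝ) ^ k)⁻¹) A) = U' ∧
          (∀ x μ, ‖A x μ‖ ≤ B * (α₀ + α₁)) ∧
          (∀ (μ : Fin 4) (x : Site 4) (κ : Fin 4), ‖covDerivFwd (((F.L : ℝ) ^ k)⁻¹) U₀ μ (fun z => A z κ) x‖ ≤ B * (α₀ + α₁)) ∧
          IsLandau138 F.L k (((F.L : ℝ) ^ k)⁻¹) Set.univ (torusLam k) U₀ A ∧
          (∀ (μ : Fin 4) (y : Site 4) (κ : Fin 4),
            ‖Ad (U₀ y μ) (covDerivFwd (((F.L : ℝ) ^ k)⁻¹) U₀ μ (fun z => A z κ) (y + e μ)) - covDerivFwd (((F.L : ℝ) ^ k)⁻¹) U₀ μ (fun z => A z κ) y‖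
              ≤ Bh * (α₀ + α₁) * (((F.L : ℝ)⁻¹) ^ k) ^ β) ∧
          (∀ (x : Site 4) (κ : Fin 4), ‖covLap (((F.L : ℝ) ^ k)⁻¹) U₀ (fun z => A z κ) x‖ ≤ B * (α₀ + α₁))))
    (h3 : LeafH3sup 4 F.L o.Nper o.ε b' c' o.dom) :
    PrintSlotHolder (ne3OfRecord₁₁ F o) β := by
  obtain ⟨-, hA3, hA2, hAs, hAc, hMcα, hC335, hss, hgrad, hℓ, hhol⟩ :=
    slotLetterLines F.L (c' + curConst 4 F.L * b' ^ 2) hα hα1 hα2 hα3 hα5 hB le_rfl hc₁' h16 hΛ₁ hΛ₂' hXα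
  exact ⟨c₁', B, Bh, b', c', α, 0, 1, fun _ => ∅, hb', hc', hRb, hcF, hα, hA3, hA2, hAs, hAc, hXα, hY, le_rfl, hMcα, fun _ _ hq => hq.elim, hC335,
    hε, hss, hgrad, hℓ, hhol, fun k hk => thm4TorusAt_of_reg_true (hT k hk) _, h3⟩

/-- **★ THE WINDOW RECIPE FOR THE PRINT β-SLOT, LINEAR** — N07's leaf letters `0 ≤ b' ≤ α∕2048`, `0 ≤ c' ≤ α∕24` (module 17's `leafLines_of_linear`, extra window line
`α ≤ 1∕((M_L+12)(1+K_L)+1)`); everything else as in `…_window_lines`. [cite: Balaban1985RegularSpaces, Thm 4 p.88, (1.36)–(1.39) pp.82–83] [folklore] -/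
theorem printSlotHolder_ofRecord_of_entry_window_linear (F : T4Family) (o : NE3Objects₁₁ N) {β : ℝ}
    {c₁' B Bh : ℝ} (hB : 0 < B) (hc₁' : 0 < c₁') (h16 : 16 * (B * c₁') ≤ 1)
    {α : ℝ} (hα : 0 < α) (hα1 : α ≤ c₁' / 177) (hα2 : α ≤ o.Λ₁ / (1770 * B + 1)) (hα3 : α ≤ c2' 4 F.L / 2)
    (hα4 : α ≤ 1 / ((23040 * (4 : ℝ) ^ 4 * (frameC 4 F.L + 4) ^ 3 + 12) * (1 + curConst 4 F.L) + 1)) (hα5 : α ≤ 1 / 10 ^ 9)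
    (hε : o.ε < α) (hΛ₁ : 0 < o.Λ₁) (hΛ₂' : 177 * α * (Bh + B) ≤ o.Λ₂')
    {b' c' : ℝ} (hb' : 0 ≤ b') (hb'α : b' ≤ α / 2048) (hc' : 0 ≤ c') (hc'α : c' ≤ α / 24)
    (hT : ∀ k, 1 ≤ k → Thm4TorusAt F.L k (((o.Nper * F.L ^ k : ℕ) : ℤ)) (((F.L : ℝ) ^ k)⁻¹) c₁' (unitaryUnits (Matrix (Fin N) (Fin N) ℂ))
      (fun _ => True) (Restr129 F.L k (torusLam k))
      (fun (α₀ α₁ : ℝ) (U₀ U' : Site 4 → Fin 4 → (Matrix (Fin N) (Fin N) ℂ)ˣ) (u : Site 4 → (Matrix (Fin N) (Fin N) ℂ)ˣ) =>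
        ∃ A : Site 4 → Fin 4 → Matrix (Fin N) (Fin N) ℂ,
          (∀ x μ, IsSelfAdjoint (A x μ)) ∧ (∀ (x : Site 4) (κ μ : Fin 4), A (x + (((o.Nper * F.L ^ k : ℕ) : ℤ)) • e κ) μ = A x μ) ∧
          mgauge U₀ u (cfgExp (((F.L : ℝ) ^ k)⁻¹) A) = U' ∧
          (∀ x μ, ‖A x μ‖ ≤ B * (α₀ + α₁)) ∧
          (∀ (μ : Fin 4) (x : Site 4) (κ : Fin 4), ‖covDerivFwd (((F.L : ℝ) ^ k)⁻¹) U₀ μ (fun z => A z κ) x‖ ≤ B * (α₀ + α₁)) ∧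
          IsLandau138 F.L k (((F.L : ℝ) ^ k)⁻¹) Set.univ (torusLam k) U₀ A ∧
          (∀ (μ : Fin 4) (y : Site 4) (κ : Fin 4),
            ‖Ad (U₀ y μ) (covDerivFwd (((F.L : ℝ) ^ k)⁻¹) U₀ μ (fun z => A z κ) (y + e μ)) - covDerivFwd (((F.L : ℝ) ^ k)⁻¹) U₀ μ (fun z => A z κ) y‖
              ≤ Bh * (α₀ + α₁) * (((F.L : ℝ)⁻¹) ^ k) ^ β) ∧
          (∀ (x : Site 4) (κ : Fin 4), ‖covLap (((F.L : ℝ) ^ k)⁻¹) U₀ (fun z => A z κ) x‖ ≤ B * (α₀ + α₁))))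
    (h3 : LeafH3sup 4 F.L o.Nper o.ε b' c' o.dom) :
    PrintSlotHolder (ne3OfRecord₁₁ F o) β :=
  have h := leafLines_of_linear (le_trans one_le_two (HistoryFlow.two_le_L F)) hα hα3 hα4 hα5 hb' hb'α hc'α
  printSlotHolder_ofRecord_of_entry_window_lines F o hB hc₁' h16 hα hα1 hα2 hα3 hα5 hε hΛ₁ hΛ₂' hb' hc' h.1 h.2.1 h.2.2.1 h.2.2.2 hT h3

/-! ## §3 Per family: letters with THE END's β-uniform proviso, the PRINT β-slot and N21's numerals, from the entry object and N07's linear leaf -/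

section PerFamily

variable [NeZero N] {β : ℝ}

/-- **★★ PER FAMILY: LETTERS WITH THE β-UNIFORM PROVISO, dag-n16-c's PRINT β-SLOT, AND N21's NUMERALS, FROM N16's CHAIN-ENTRY OBJECT AND N07's LINEAR LEAF** — `hE`: ONE
`(B, B_h, c₁')` (`0 < B`, `0 < c₁'`, `16·(B·c₁') ≤ 1`) and (T4ᵀ_print)_β at every depth `k ≥ 1` (`Reg := ⊤`) at `(F.L, ne3NperOfRecord₁₁ F 0 0)`; `h7`: N07's linear leaf for
`0 < ε ≤ ε₀` at RR-1's period and data of record; `g > 0`.  THEN letters `ℓ` (identities, numeral, `0 < ℓ.Λ₂'`) with `InEndRegimeH ∧ PrintSlotHolder · β` at RR-1's object (§1 ∘ (F2)'s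
`inEndRegimeH_ofRecord_of_window` ∘ §2 `…_linear`, `b' = c' = C·ℓ.ε`) — module 35 §2 with `h5 ↦ hE`, print slot for leaf slot. [cite: Balaban1985RegularSpaces, Thm 4 p.88; Balaban1985Variational, Thm 1 p.279] [folklore] -/
theorem exists_letters_inEndRegimeH_printSlotHolder_of_entry (F : T4Family) {g : ℝ} (hg : 0 < g)
    (hE : ∃ B Bh c₁' : ℝ, 0 < B ∧ 0 < c₁' ∧ 16 * (B * c₁') ≤ 1 ∧
      ∀ k, 1 ≤ k → Thm4TorusAt F.L k (((ne3NperOfRecord₁₁ F 0 0 * F.L ^ k : ℕ) : ℤ)) (((F.L : ℝ) ^ k)⁻¹) c₁' (unitaryUnits (Matrix (Fin N) (Fin N) ℂ))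
        (fun _ => True) (Restr129 F.L k (torusLam k))
        (fun (α₀ α₁ : ℝ) (U₀ U' : Site 4 → Fin 4 → (Matrix (Fin N) (Fin N) ℂ)ˣ) (u : Site 4 → (Matrix (Fin N) (Fin N) ℂ)ˣ) =>
          ∃ A : Site 4 → Fin 4 → Matrix (Fin N) (Fin N) ℂ,
            (∀ x μ, IsSelfAdjoint (A x μ)) ∧ (∀ (x : Site 4) (κ μ : Fin 4), A (x + (((ne3NperOfRecord₁₁ F 0 0 * F.L ^ k : ℕ) : ℤ)) • e κ) μ = A x μ) ∧
            mgauge U₀ u (cfgExp (((F.L : ℝ) ^ k)⁻¹) A) = U' ∧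
            (∀ x μ, ‖A x μ‖ ≤ B * (α₀ + α₁)) ∧
            (∀ (μ : Fin 4) (x : Site 4) (κ : Fin 4), ‖covDerivFwd (((F.L : ℝ) ^ k)⁻¹) U₀ μ (fun z => A z κ) x‖ ≤ B * (α₀ + α₁)) ∧
            IsLandau138 F.L k (((F.L : ℝ) ^ k)⁻¹) Set.univ (torusLam k) U₀ A ∧
            (∀ (μ : Fin 4) (y : Site 4) (κ : Fin 4),
              ‖Ad (U₀ y μ) (covDerivFwd (((F.L : ℝ) ^ k)⁻¹) U₀ μ (fun z => A z κ) (y + e μ)) - covDerivFwd (((F.L : ℝ) ^ k)⁻¹) U₀ μ (fun z => A z κ) y‖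
                ≤ Bh * (α₀ + α₁) * (((F.L : ℝ)⁻¹) ^ k) ^ β) ∧
            (∀ (x : Site 4) (κ : Fin 4), ‖covLap (((F.L : ℝ) ^ k)⁻¹) U₀ (fun z => A z κ) x‖ ≤ B * (α₀ + α₁))))
    (h7 : ∃ C ε₀ : ℝ, 0 ≤ C ∧ 0 < ε₀ ∧ ∀ ε : ℝ, 0 < ε → ε ≤ ε₀ →
      LeafH3sup 4 F.L (ne3NperOfRecord₁₁ F 0 0) ε (C * ε) (C * ε) (ne3DomOfRecord₁₁ F N 0 0)) :
    ∃ ℓ : NE3Letters₁₁, ℓ.g = g ∧ ℓ.Λ₁ = radiusOfRecordH N F.L (ne3NperOfRecord₁₁ F 0 0) ∧ ℓ.C = constOfRecordH N F.L (ne3NperOfRecord₁₁ F 0 0) g ∧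
      0 < ℓ.b ∧ 512 * (4 + 1) * (4 + 4) * (F.L : ℝ) ^ 2 * ℓ.b ≤ 1 ∧ 0 < ℓ.Λ₂' ∧
      InEndRegimeH (ne3OfRecord₁₁ F (ne3ConstLayerOfRecord₁₁ F N ℓ)) ∧ PrintSlotHolder (ne3OfRecord₁₁ F (ne3ConstLayerOfRecord₁₁ F N ℓ)) β := by
  obtain ⟨B, Bh, c₁', hB, hc₁', h16, hT⟩ := hE
  obtain ⟨C, ε₀, hC, hε₀, h3⟩ := h7
  have hL : 2 ≤ F.L := HistoryFlow.two_le_L F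
  obtain ⟨α, ℓ, hα, hα1, hα2, hα3, hα4, hα5, hgℓ, hε0, hε, hεε₀, hCε, hεr, hΛ₁, hb0, hb, hCℓ, hΛ₂', hΛ₂'0, hnum⟩ :=
    exists_window_letters_entry F hc₁' hB Bh g (radiusOfRecordH_pos (N := N) hL (one_le_ne3NperOfRecord₁₁ F 0 0))
      (constOfRecordH N F.L (ne3NperOfRecord₁₁ F 0 0) g) hC hε₀
  have hΛpos : 0 < ℓ.Λ₁ := by rw [hΛ₁]; exact radiusOfRecordH_pos (N := N) hL (one_le_ne3NperOfRecord₁₁ F 0 0)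
  have hgpos : 0 < ℓ.g := by rw [hgℓ]; exact hg
  refine ⟨ℓ, hgℓ, hΛ₁, hCℓ, hb0, hnum, hΛ₂'0,
    inEndRegimeH_ofRecord_of_window F (ne3ConstLayerOfRecord₁₁ F N ℓ) (one_le_ne3NperOfRecord₁₁ F 0 0) hgpos hB.le hα2 hε0 hε hΛ₁.le hb0.le hb
      (show constOfRecordH N F.L (ne3NperOfRecord₁₁ F 0 0) ℓ.g ≤ ℓ.C by rw [hCℓ, hgℓ]), ?_⟩
  have hCε0 : 0 ≤ C * ℓ.ε := mul_nonneg hC hε0.le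
  exact printSlotHolder_ofRecord_of_entry_window_linear F (ne3ConstLayerOfRecord₁₁ F N ℓ) hB hc₁' h16 hα hα1 hα2 hα3 hα4 hα5 hε hΛpos hΛ₂' hCε0 hCε hCε0
    (hCε.trans (by linarith only [hα.le] : α / 2048 ≤ α / 24)) hT (h3 ℓ.ε hε0 hεε₀)

/-- **★★ PER FAMILY: `N16HolderAt · β` AT LETTERS OF RECORD FROM THE ENTRY OBJECT AND N07's LINEAR LEAF** (`β ≤ 1`, no sign condition) — §3 then dag-n16-c's ONE-APPLICATION
CLOSER `n16HolderAt_of_inEndRegimeH_printSlotHolder` (packaging `n16_holder_of_thm4TorusAt_print`, THE END's road).  N16 NOT discharged: `hE`, `h7` are the hypotheses.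
[cite: Balaban1985RegularSpaces, Thm 4 p.88; Balaban1985Variational, Thm 1 p.279] [folklore] -/
theorem exists_letters_n16HolderAt_of_entry (hβ1 : β ≤ 1) (F : T4Family) {g : ℝ} (hg : 0 < g)
    (hE : ∃ B Bh c₁' : ℝ, 0 < B ∧ 0 < c₁' ∧ 16 * (B * c₁') ≤ 1 ∧
      ∀ k, 1 ≤ k → Thm4TorusAt F.L k (((ne3NperOfRecord₁₁ F 0 0 * F.L ^ k : ℕ) : ℤ)) (((F.L : ℝ) ^ k)⁻¹) c₁' (unitaryUnits (Matrix (Fin N) (Fin N) ℂ))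
        (fun _ => True) (Restr129 F.L k (torusLam k))
        (fun (α₀ α₁ : ℝ) (U₀ U' : Site 4 → Fin 4 → (Matrix (Fin N) (Fin N) ℂ)ˣ) (u : Site 4 → (Matrix (Fin N) (Fin N) ℂ)ˣ) =>
          ∃ A : Site 4 → Fin 4 → Matrix (Fin N) (Fin N) ℂ,
            (∀ x μ, IsSelfAdjoint (A x μ)) ∧ (∀ (x : Site 4) (κ μ : Fin 4), A (x + (((ne3NperOfRecord₁₁ F 0 0 * F.L ^ k : ℕ) : ℤ)) • e κ) μ = A x μ) ∧
            mgauge U₀ u (cfgExp (((F.L : ℝ) ^ k)⁻¹) A) = U' ∧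
            (∀ x μ, ‖A x μ‖ ≤ B * (α₀ + α₁)) ∧
            (∀ (μ : Fin 4) (x : Site 4) (κ : Fin 4), ‖covDerivFwd (((F.L : ℝ) ^ k)⁻¹) U₀ μ (fun z => A z κ) x‖ ≤ B * (α₀ + α₁)) ∧
            IsLandau138 F.L k (((F.L : ℝ) ^ k)⁻¹) Set.univ (torusLam k) U₀ A ∧
            (∀ (μ : Fin 4) (y : Site 4) (κ : Fin 4),
              ‖Ad (U₀ y μ) (covDerivFwd (((F.L : ℝ) ^ k)⁻¹) U₀ μ (fun z => A z κ) (y + e μ)) - covDerivFwd (((F.L : ℝ) ^ k)⁻¹) U₀ μ (fun z => A z κ) y‖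
                ≤ Bh * (α₀ + α₁) * (((F.L : ℝ)⁻¹) ^ k) ^ β) ∧
            (∀ (x : Site 4) (κ : Fin 4), ‖covLap (((F.L : ℝ) ^ k)⁻¹) U₀ (fun z => A z κ) x‖ ≤ B * (α₀ + α₁))))
    (h7 : ∃ C ε₀ : ℝ, 0 ≤ C ∧ 0 < ε₀ ∧ ∀ ε : ℝ, 0 < ε → ε ≤ ε₀ →
      LeafH3sup 4 F.L (ne3NperOfRecord₁₁ F 0 0) ε (C * ε) (C * ε) (ne3DomOfRecord₁₁ F N 0 0)) :
    ∃ ℓ : NE3Letters₁₁, ℓ.g = g ∧ ℓ.Λ₁ = radiusOfRecordH N F.L (ne3NperOfRecord₁₁ F 0 0) ∧ ℓ.C = constOfRecordH N F.L (ne3NperOfRecord₁₁ F 0 0) g ∧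
      0 < ℓ.b ∧ 512 * (4 + 1) * (4 + 4) * (F.L : ℝ) ^ 2 * ℓ.b ≤ 1 ∧ 0 < ℓ.Λ₂' ∧
      InEndRegimeH (ne3OfRecord₁₁ F (ne3ConstLayerOfRecord₁₁ F N ℓ)) ∧ PrintSlotHolder (ne3OfRecord₁₁ F (ne3ConstLayerOfRecord₁₁ F N ℓ)) β ∧
      N16HolderAt (ne3OfRecord₁₁ F (ne3ConstLayerOfRecord₁₁ F N ℓ)) β := by
  obtain ⟨ℓ, h1, h2, h3, h4, h5, h6, hreg, hslot⟩ := exists_letters_inEndRegimeH_printSlotHolder_of_entry (N := N) F hg hE h7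
  exact ⟨ℓ, h1, h2, h3, h4, h5, h6, hreg, hslot, n16HolderAt_of_inEndRegimeH_printSlotHolder hreg hβ1 hslot⟩

end PerFamily

/-! ## §4 Reading level: module 37ᴴ's faces with `h5 ↦ hE` -/

section Holder

variable [NeZero N] {β : ℝ} (hβ1 : β ≤ 1)
variable (Rg : (F : T4Family) → Stage13HParams F N → Prop)
  (w1 : (F : T4Family) → (θ : Stage13HParams F N) → ReadingData F (MatA N) θ.τ9.M)
  (ne2 : (F : T4Family) → Stage13HParams F N → (ℕ → ℝ) → List (ULoop F) → ℕ → NE2Objects₁₁)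
  (ne1 : (F : T4Family) → Stage13HParams F N → (ℕ → ℝ) → List (ULoop F) → NE1pCarriers)
include hβ1

/-- **★★★ N16 UNDER R-β AT THE REGIME-RESTRICTED READING OF RECORD FROM ITS CHAIN-ENTRY OBJECT AND N07's LINEAR LEAF, LETTERS CHOSEN** (`β ≤ 1`) — module 37ᴴ §2's
`exists_letters_s_N16Holder_readingOfRecord₁₃CoPHOn_of_edges_allTorus` with `h5 ↦ hE`: letters `ℓ₃` with the composer's `h16 : S_N16Holder β (RRec₁₃CoPHOn (readingOfRecord₁₃CoPH w1 ℓ₃ ne2 ne1) Rg)`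
AND, per family, identities, numerals, β-uniform proviso and PRINT β-slot; `Rg`, `w1`, `ne2`, `ne1` free. [cite: Balaban1985RegularSpaces, Thm 4 p.88; Balaban1985Variational, Thm 1 p.279] [folklore] -/
theorem exists_letters_s_N16Holder_readingOfRecord₁₃CoPHOn_of_entry {g : T4Family → ℝ} (hg : ∀ F, 0 < g F)
    (hE : ∀ F : T4Family, ∃ B Bh c₁' : ℝ, 0 < B ∧ 0 < c₁' ∧ 16 * (B * c₁') ≤ 1 ∧
      ∀ k, 1 ≤ k → Thm4TorusAt F.L k (((ne3NperOfRecord₁₁ F 0 0 * F.L ^ k : ℕ) : ℤ)) (((F.L : ℝ) ^ k)⁻¹) c₁' (unitaryUnits (Matrix (Fin N) (Fin N) ℂ))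
        (fun _ => True) (Restr129 F.L k (torusLam k))
        (fun (α₀ α₁ : ℝ) (U₀ U' : Site 4 → Fin 4 → (Matrix (Fin N) (Fin N) ℂ)ˣ) (u : Site 4 → (Matrix (Fin N) (Fin N) ℂ)ˣ) =>
          ∃ A : Site 4 → Fin 4 → Matrix (Fin N) (Fin N) ℂ,
            (∀ x μ, IsSelfAdjoint (A x μ)) ∧ (∀ (x : Site 4) (κ μ : Fin 4), A (x + (((ne3NperOfRecord₁₁ F 0 0 * F.L ^ k : ℕ) : ℤ)) • e κ) μ = A x μ) ∧
            mgauge U₀ u (cfgExp (((F.L : ℝ) ^ k)⁻¹) A) = U' ∧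
            (∀ x μ, ‖A x μ‖ ≤ B * (α₀ + α₁)) ∧
            (∀ (μ : Fin 4) (x : Site 4) (κ : Fin 4), ‖covDerivFwd (((F.L : ℝ) ^ k)⁻¹) U₀ μ (fun z => A z κ) x‖ ≤ B * (α₀ + α₁)) ∧
            IsLandau138 F.L k (((F.L : ℝ) ^ k)⁻¹) Set.univ (torusLam k) U₀ A ∧
            (∀ (μ : Fin 4) (y : Site 4) (κ : Fin 4),
              ‖Ad (U₀ y μ) (covDerivFwd (((F.L : ℝ) ^ k)⁻¹) U₀ μ (fun z => A z κ) (y + e μ)) - covDerivFwd (((F.L : ℝ) ^ k)⁻¹) U₀ μ (fun z => A z κ) y‖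
                ≤ Bh * (α₀ + α₁) * (((F.L : ℝ)⁻¹) ^ k) ^ β) ∧
            (∀ (x : Site 4) (κ : Fin 4), ‖covLap (((F.L : ℝ) ^ k)⁻¹) U₀ (fun z => A z κ) x‖ ≤ B * (α₀ + α₁))))
    (h7 : ∀ F : T4Family, ∃ C ε₀ : ℝ, 0 ≤ C ∧ 0 < ε₀ ∧ ∀ ε : ℝ, 0 < ε → ε ≤ ε₀ →
      LeafH3sup 4 F.L (ne3NperOfRecord₁₁ F 0 0) ε (C * ε) (C * ε) (ne3DomOfRecord₁₁ F N 0 0)) :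
    ∃ ℓ₃ : T4Family → NE3Letters₁₁,
      S_N16Holder β (RRec₁₃CoPHOn (readingOfRecord₁₃CoPH w1 ℓ₃ ne2 ne1) Rg) ∧
      ∀ F : T4Family, (ℓ₃ F).g = g F ∧ (ℓ₃ F).Λ₁ = radiusOfRecordH N F.L (ne3NperOfRecord₁₁ F 0 0) ∧
        (ℓ₃ F).C = constOfRecordH N F.L (ne3NperOfRecord₁₁ F 0 0) (g F) ∧
        0 < (ℓ₃ F).b ∧ 512 * (4 + 1) * (4 + 4) * (F.L : ℝ) ^ 2 * (ℓ₃ F).b ≤ 1 ∧ 0 < (ℓ₃ F).Λ₂' ∧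
        InEndRegimeH (ne3OfRecord₁₁ F (ne3ConstLayerOfRecord₁₁ F N (ℓ₃ F))) ∧ PrintSlotHolder (ne3OfRecord₁₁ F (ne3ConstLayerOfRecord₁₁ F N (ℓ₃ F))) β := by
  choose ℓ₃ hℓ₃ using fun F => exists_letters_inEndRegimeH_printSlotHolder_of_entry (N := N) F (hg F) (hE F) (h7 F)
  exact ⟨ℓ₃, (s_N16Holder_rRec₁₃CoPHOn_iff_ofRecord β (readingOfRecord₁₃CoPH w1 ℓ₃ ne2 ne1) Rg ℓ₃ (readingOfRecord₁₃CoPH_ne3 w1 ℓ₃ ne2 ne1)).2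
    fun F _ => n16HolderAt_of_inEndRegimeH_printSlotHolder (hℓ₃ F).2.2.2.2.2.2.1 hβ1 (hℓ₃ F).2.2.2.2.2.2.2, hℓ₃⟩

/-- **★★★ THE SAME AT THE CANONICAL READING OF RECORD** (module 37ᴴ §2's `…₁₃CoPH_of_edges_allTorus` with `h5 ↦ hE`). [cite: Balaban1985RegularSpaces, Thm 4 p.88] [folklore] -/
theorem exists_letters_s_N16Holder_readingOfRecord₁₃CoPH_of_entry {g : T4Family → ℝ} (hg : ∀ F, 0 < g F)
    (hE : ∀ F : T4Family, ∃ B Bh c₁' : ℝ, 0 < B ∧ 0 < c₁' ∧ 16 * (B * c₁') ≤ 1 ∧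
      ∀ k, 1 ≤ k → Thm4TorusAt F.L k (((ne3NperOfRecord₁₁ F 0 0 * F.L ^ k : ℕ) : ℤ)) (((F.L : ℝ) ^ k)⁻¹) c₁' (unitaryUnits (Matrix (Fin N) (Fin N) ℂ))
        (fun _ => True) (Restr129 F.L k (torusLam k))
        (fun (α₀ α₁ : ℝ) (U₀ U' : Site 4 → Fin 4 → (Matrix (Fin N) (Fin N) ℂ)ˣ) (u : Site 4 → (Matrix (Fin N) (Fin N) ℂ)ˣ) =>
          ∃ A : Site 4 → Fin 4 → Matrix (Fin N) (Fin N) ℂ,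
            (∀ x μ, IsSelfAdjoint (A x μ)) ∧ (∀ (x : Site 4) (κ μ : Fin 4), A (x + (((ne3NperOfRecord₁₁ F 0 0 * F.L ^ k : ℕ) : ℤ)) • e κ) μ = A x μ) ∧
            mgauge U₀ u (cfgExp (((F.L : ℝ) ^ k)⁻¹) A) = U' ∧
            (∀ x μ, ‖A x μ‖ ≤ B * (α₀ + α₁)) ∧
            (∀ (μ : Fin 4) (x : Site 4) (κ : Fin 4), ‖covDerivFwd (((F.L : ℝ) ^ k)⁻¹) U₀ μ (fun z => A z κ) x‖ ≤ B * (α₀ + α₁)) ∧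
            IsLandau138 F.L k (((F.L : ℝ) ^ k)⁻¹) Set.univ (torusLam k) U₀ A ∧
            (∀ (μ : Fin 4) (y : Site 4) (κ : Fin 4),
              ‖Ad (U₀ y μ) (covDerivFwd (((F.L : ℝ) ^ k)⁻¹) U₀ μ (fun z => A z κ) (y + e μ)) - covDerivFwd (((F.L : ℝ) ^ k)⁻¹) U₀ μ (fun z => A z κ) y‖
                ≤ Bh * (α₀ + α₁) * (((F.L : ℝ)⁻¹) ^ k) ^ β) ∧
            (∀ (x : Site 4) (κ : Fin 4), ‖covLap (((F.L : ℝ) ^ k)⁻¹) U₀ (fun z => A z κ) x‖ ≤ B * (α₀ + α₁))))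
    (h7 : ∀ F : T4Family, ∃ C ε₀ : ℝ, 0 ≤ C ∧ 0 < ε₀ ∧ ∀ ε : ℝ, 0 < ε → ε ≤ ε₀ →
      LeafH3sup 4 F.L (ne3NperOfRecord₁₁ F 0 0) ε (C * ε) (C * ε) (ne3DomOfRecord₁₁ F N 0 0)) :
    ∃ ℓ₃ : T4Family → NE3Letters₁₁,
      S_N16Holder β (RRec₁₃CoPH (readingOfRecord₁₃CoPH w1 ℓ₃ ne2 ne1)) ∧
      ∀ F : T4Family, (ℓ₃ F).g = g F ∧ (ℓ₃ F).Λ₁ = radiusOfRecordH N F.L (ne3NperOfRecord₁₁ F 0 0) ∧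
        (ℓ₃ F).C = constOfRecordH N F.L (ne3NperOfRecord₁₁ F 0 0) (g F) ∧
        0 < (ℓ₃ F).b ∧ 512 * (4 + 1) * (4 + 4) * (F.L : ℝ) ^ 2 * (ℓ₃ F).b ≤ 1 ∧ 0 < (ℓ₃ F).Λ₂' ∧
        InEndRegimeH (ne3OfRecord₁₁ F (ne3ConstLayerOfRecord₁₁ F N (ℓ₃ F))) ∧ PrintSlotHolder (ne3OfRecord₁₁ F (ne3ConstLayerOfRecord₁₁ F N (ℓ₃ F))) β := by
  choose ℓ₃ hℓ₃ using fun F => exists_letters_inEndRegimeH_printSlotHolder_of_entry (N := N) F (hg F) (hE F) (h7 F)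
  exact ⟨ℓ₃, (s_N16Holder_rRec₁₃CoPH_iff_of_constLayer β (readingOfRecord₁₃CoPH w1 ℓ₃ ne2 ne1) (fun F => ne3ConstLayerOfRecord₁₁ F N (ℓ₃ F))
      (readingOfRecord₁₃CoPH_ne3 w1 ℓ₃ ne2 ne1)).2
    fun F _ => n16HolderAt_of_inEndRegimeH_printSlotHolder (hℓ₃ F).2.2.2.2.2.2.1 hβ1 (hℓ₃ F).2.2.2.2.2.2.2, hℓ₃⟩

end Holder

section One

variable [NeZero N]
variable (Rg : (F : T4Family) → Stage13HParams F N → Prop)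
  (w1 : (F : T4Family) → (θ : Stage13HParams F N) → ReadingData F (MatA N) θ.τ9.M)
  (ne2 : (F : T4Family) → Stage13HParams F N → (ℕ → ℝ) → List (ULoop F) → ℕ → NE2Objects₁₁)
  (ne1 : (F : T4Family) → Stage13HParams F N → (ℕ → ℝ) → List (ULoop F) → NE1pCarriers)

/-- **★★★ N16 (THE STUB OF RECORD, β = 1) AT THE REGIME-RESTRICTED READING OF RECORD FROM ITS CHAIN-ENTRY OBJECT AT EXPONENT `1` AND N07's LINEAR LEAF** — module 37ᴴ §1 with
`h5 ↦ hE`: `h16 : S_N16 (RRec₁₃CoPHOn (readingOfRecord₁₃CoPH w1 ℓ₃ ne2 ne1) Rg)`, per-family identities, numerals, β-uniform proviso and n16-e's PRINT SLOT OF RECORD `PrintSlot`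
(`printSlotHolder_one_iff`). [cite: Balaban1985RegularSpaces, Thm 4 p.88; Balaban1985Variational, Thm 1 p.279] [folklore] -/
theorem exists_letters_s_N16_readingOfRecord₁₃CoPHOn_of_entry {g : T4Family → ℝ} (hg : ∀ F, 0 < g F)
    (hE : ∀ F : T4Family, ∃ B Bh c₁' : ℝ, 0 < B ∧ 0 < c₁' ∧ 16 * (B * c₁') ≤ 1 ∧
      ∀ k, 1 ≤ k → Thm4TorusAt F.L k (((ne3NperOfRecord₁₁ F 0 0 * F.L ^ k : ℕ) : ℤ)) (((F.L : ℝ) ^ k)⁻¹) c₁' (unitaryUnits (Matrix (Fin N) (Fin N) ℂ))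
        (fun _ => True) (Restr129 F.L k (torusLam k))
        (fun (α₀ α₁ : ℝ) (U₀ U' : Site 4 → Fin 4 → (Matrix (Fin N) (Fin N) ℂ)ˣ) (u : Site 4 → (Matrix (Fin N) (Fin N) ℂ)ˣ) =>
          ∃ A : Site 4 → Fin 4 → Matrix (Fin N) (Fin N) ℂ,
            (∀ x μ, IsSelfAdjoint (A x μ)) ∧ (∀ (x : Site 4) (κ μ : Fin 4), A (x + (((ne3NperOfRecord₁₁ F 0 0 * F.L ^ k : ℕ) : ℤ)) • e κ) μ = A x μ) ∧
            mgauge U₀ u (cfgExp (((F.L : ℝ) ^ k)⁻¹) A) = U' ∧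
            (∀ x μ, ‖A x μ‖ ≤ B * (α₀ + α₁)) ∧
            (∀ (μ : Fin 4) (x : Site 4) (κ : Fin 4), ‖covDerivFwd (((F.L : ℝ) ^ k)⁻¹) U₀ μ (fun z => A z κ) x‖ ≤ B * (α₀ + α₁)) ∧
            IsLandau138 F.L k (((F.L : ℝ) ^ k)⁻¹) Set.univ (torusLam k) U₀ A ∧
            (∀ (μ : Fin 4) (y : Site 4) (κ : Fin 4),
              ‖Ad (U₀ y μ) (covDerivFwd (((F.L : ℝ) ^ k)⁻¹) U₀ μ (fun z => A z κ) (y + e μ)) - covDerivFwd (((F.L : ℝ) ^ k)⁻¹) U₀ μ (fun z => A z κ) y‖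
                ≤ Bh * (α₀ + α₁) * (((F.L : ℝ)⁻¹) ^ k) ^ (1 : ℝ)) ∧
            (∀ (x : Site 4) (κ : Fin 4), ‖covLap (((F.L : ℝ) ^ k)⁻¹) U₀ (fun z => A z κ) x‖ ≤ B * (α₀ + α₁))))
    (h7 : ∀ F : T4Family, ∃ C ε₀ : ℝ, 0 ≤ C ∧ 0 < ε₀ ∧ ∀ ε : ℝ, 0 < ε → ε ≤ ε₀ →
      LeafH3sup 4 F.L (ne3NperOfRecord₁₁ F 0 0) ε (C * ε) (C * ε) (ne3DomOfRecord₁₁ F N 0 0)) :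
    ∃ ℓ₃ : T4Family → NE3Letters₁₁,
      S_N16 (RRec₁₃CoPHOn (readingOfRecord₁₃CoPH w1 ℓ₃ ne2 ne1) Rg) ∧
      ∀ F : T4Family, (ℓ₃ F).g = g F ∧ (ℓ₃ F).Λ₁ = radiusOfRecordH N F.L (ne3NperOfRecord₁₁ F 0 0) ∧
        (ℓ₃ F).C = constOfRecordH N F.L (ne3NperOfRecord₁₁ F 0 0) (g F) ∧
        0 < (ℓ₃ F).b ∧ 512 * (4 + 1) * (4 + 4) * (F.L : ℝ) ^ 2 * (ℓ₃ F).b ≤ 1 ∧ 0 < (ℓ₃ F).Λ₂' ∧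
        InEndRegimeH (ne3OfRecord₁₁ F (ne3ConstLayerOfRecord₁₁ F N (ℓ₃ F))) ∧ PrintSlot (ne3OfRecord₁₁ F (ne3ConstLayerOfRecord₁₁ F N (ℓ₃ F))) := by
  choose ℓ₃ hℓ₃ using fun F => exists_letters_inEndRegimeH_printSlotHolder_of_entry (N := N) (β := 1) F (hg F) (hE F) (h7 F)
  refine ⟨ℓ₃, (s_N16_rRec₁₃CoPHOn_iff_ofRecord (readingOfRecord₁₃CoPH w1 ℓ₃ ne2 ne1) Rg ℓ₃ (readingOfRecord₁₃CoPH_ne3 w1 ℓ₃ ne2 ne1)).2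
    fun F _ => n16At_of_inEndRegimeH_printSlot (hℓ₃ F).2.2.2.2.2.2.1 ((printSlotHolder_one_iff _).1 (hℓ₃ F).2.2.2.2.2.2.2), fun F => ?_⟩
  obtain ⟨h1, h2, h3, h4, h5, h6, hreg, hslot⟩ := hℓ₃ F
  exact ⟨h1, h2, h3, h4, h5, h6, hreg, (printSlotHolder_one_iff _).1 hslot⟩

/-- **★★★ THE SAME AT THE CANONICAL READING OF RECORD** (module 37ᴴ §1's `…₁₃CoPH_of_edges_allTorus` with `h5 ↦ hE`). [cite: Balaban1985RegularSpaces, Thm 4 p.88] [folklore] -/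
theorem exists_letters_s_N16_readingOfRecord₁₃CoPH_of_entry {g : T4Family → ℝ} (hg : ∀ F, 0 < g F)
    (hE : ∀ F : T4Family, ∃ B Bh c₁' : ℝ, 0 < B ∧ 0 < c₁' ∧ 16 * (B * c₁') ≤ 1 ∧
      ∀ k, 1 ≤ k → Thm4TorusAt F.L k (((ne3NperOfRecord₁₁ F 0 0 * F.L ^ k : ℕ) : ℤ)) (((F.L : ℝ) ^ k)⁻¹) c₁' (unitaryUnits (Matrix (Fin N) (Fin N) ℂ))
        (fun _ => True) (Restr129 F.L k (torusLam k))
        (fun (α₀ α₁ : ℝ) (U₀ U' : Site 4 → Fin 4 → (Matrix (Fin N) (Fin N) ℂ)ˣ) (u : Site 4 → (Matrix (Fin N) (Fin N) ℂ)ˣ) =>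
          ∃ A : Site 4 → Fin 4 → Matrix (Fin N) (Fin N) ℂ,
            (∀ x μ, IsSelfAdjoint (A x μ)) ∧ (∀ (x : Site 4) (κ μ : Fin 4), A (x + (((ne3NperOfRecord₁₁ F 0 0 * F.L ^ k : ℕ) : ℤ)) • e κ) μ = A x μ) ∧
            mgauge U₀ u (cfgExp (((F.L : ℝ) ^ k)⁻¹) A) = U' ∧
            (∀ x μ, ‖A x μ‖ ≤ B * (α₀ + α₁)) ∧
            (∀ (μ : Fin 4) (x : Site 4) (κ : Fin 4), ‖covDerivFwd (((F.L : ℝ) ^ k)⁻¹) U₀ μ (fun z => A z κ) x‖ ≤ B * (α₀ + α₁)) ∧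
            IsLandau138 F.L k (((F.L : ℝ) ^ k)⁻¹) Set.univ (torusLam k) U₀ A ∧
            (∀ (μ : Fin 4) (y : Site 4) (κ : Fin 4),
              ‖Ad (U₀ y μ) (covDerivFwd (((F.L : ℝ) ^ k)⁻¹) U₀ μ (fun z => A z κ) (y + e μ)) - covDerivFwd (((F.L : ℝ) ^ k)⁻¹) U₀ μ (fun z => A z κ) y‖
                ≤ Bh * (α₀ + α₁) * (((F.L : ℝ)⁻¹) ^ k) ^ (1 : ℝ)) ∧
            (∀ (x : Site 4) (κ : Fin 4), ‖covLap (((F.L : ℝ) ^ k)⁻¹) U₀ (fun z => A z κ) x‖ ≤ B * (α₀ + α₁))))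
    (h7 : ∀ F : T4Family, ∃ C ε₀ : ℝ, 0 ≤ C ∧ 0 < ε₀ ∧ ∀ ε : ℝ, 0 < ε → ε ≤ ε₀ →
      LeafH3sup 4 F.L (ne3NperOfRecord₁₁ F 0 0) ε (C * ε) (C * ε) (ne3DomOfRecord₁₁ F N 0 0)) :
    ∃ ℓ₃ : T4Family → NE3Letters₁₁,
      S_N16 (RRec₁₃CoPH (readingOfRecord₁₃CoPH w1 ℓ₃ ne2 ne1)) ∧
      ∀ F : T4Family, (ℓ₃ F).g = g F ∧ (ℓ₃ F).Λ₁ = radiusOfRecordH N F.L (ne3NperOfRecord₁₁ F 0 0) ∧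
        (ℓ₃ F).C = constOfRecordH N F.L (ne3NperOfRecord₁₁ F 0 0) (g F) ∧
        0 < (ℓ₃ F).b ∧ 512 * (4 + 1) * (4 + 4) * (F.L : ℝ) ^ 2 * (ℓ₃ F).b ≤ 1 ∧ 0 < (ℓ₃ F).Λ₂' ∧
        InEndRegimeH (ne3OfRecord₁₁ F (ne3ConstLayerOfRecord₁₁ F N (ℓ₃ F))) ∧ PrintSlot (ne3OfRecord₁₁ F (ne3ConstLayerOfRecord₁₁ F N (ℓ₃ F))) := by
  choose ℓ₃ hℓ₃ using fun F => exists_letters_inEndRegimeH_printSlotHolder_of_entry (N := N) (β := 1) F (hg F) (hE F) (h7 F)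
  refine ⟨ℓ₃, (s_N16_rRec₁₃CoPH_iff_of_constLayer (readingOfRecord₁₃CoPH w1 ℓ₃ ne2 ne1) (fun F => ne3ConstLayerOfRecord₁₁ F N (ℓ₃ F))
      (readingOfRecord₁₃CoPH_ne3 w1 ℓ₃ ne2 ne1)).2
    fun F _ => n16At_of_inEndRegimeH_printSlot (hℓ₃ F).2.2.2.2.2.2.1 ((printSlotHolder_one_iff _).1 (hℓ₃ F).2.2.2.2.2.2.2), fun F => ?_⟩
  obtain ⟨h1, h2, h3, h4, h5, h6, hreg, hslot⟩ := hℓ₃ F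
  exact ⟨h1, h2, h3, h4, h5, h6, hreg, (printSlotHolder_one_iff _).1 hslot⟩

end One

end

end Summit.QuantumFields.YangMills.BalabanUVNodes.N16OfEntryAtRecord13CoPH
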